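import Literature.Geometry.Kaehler.ComplexTorusSubtorusCycleClassFrameChange
import Literature.Geometry.Kaehler.ComplexTorusHodgeClassesProduct
import Literature.Geometry.Kaehler.ComplexTorusPoincareReducibility
import HarnessLib

/-!
# The cycle class of a complex subtorus, III: the factor subtorus `X₁ × {0} ⊂ X₁ × X₂`

Layer `Literature/Geometry/Kaehler`, namespace `Literature.Geometry.Kaehler.ComplexTorus`; lane
`lit-hodgefound`, Layer A4, row A4-18(b) validation (§P Q45, prover `lit-hodgefound-p08`), sequel of
`ComplexTorusSubtorusCycleClass.lean` (`volumeForm`, `torusIntegral`, `SubtorusFrame`,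
`SubtorusFrame.cycleForm`: `[Z] = (Φu) ⌟ vol`, `∫_X η ∧ [Z] = ∫_Z η`) and
`ComplexTorusSubtorusCycleClassFrameChange.lean` (`[Z]` depends only on `Z`; `[X] = 1`), over the
product torus `X₁ × X₂ = (E₁ × E₂)/(Λ₁ ⊕ Λ₂)` of `ComplexTorusProduct.lean` (`prodPeriod Φ₁ Φ₂`,
`prodHomeomorph`).

* `IsPosOriented.append` (with `det_realBasisOfComplex_prod_append`) — **the product orientation is
  the complex orientation**: concatenating positively oriented real frames `(w₁, 0) ⊔ (0, w₂)` of two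
  complex vector spaces gives a positively oriented frame of `W₁ × W₂` (the real basis underlying the
  product complex basis is block diagonal on such frames; Griffiths–Harris Ch. 0 §2, Voisin (2002)
  §11.1.2).
* `sumEnum e₁ e₂` — the concatenated enumeration of the lattice basis of `Λ₁ ⊕ Λ₂`; `fstFrame e₁` — the
  lattice basis of `Λ₁ ⊕ 0`; **`SubtorusFrame.fstFactor`** — the factor subtorus `X₁ × {0}` as a
  subtorus datum of `X₁ × X₂` (saturated: `(Λ₁ ⊕ Λ₂) ∩ (E₁ × 0) = Λ₁ ⊕ 0`; positively oriented by a
  positively oriented enumeration `e₁` of `Λ₁`), with `image_carrier_fstFactor`: its carrier is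
  `X₁ × {0}` under `prodHomeomorph` (Lange–Birkenhake, §5.3; Exercise 1.1.6 (2)(a)).
* `latticeBasis_det_sumEnum_append` (block-triangular determinant), **`orientationSign_sumEnum`**:
  the orientation sign of the concatenated enumeration is that of `e₂` when `e₁` is positively
  oriented.
* **`SubtorusFrame.cycleForm_fstFactor_apply`, `cycleForm_fstFactor`, `cycleClass_fstFactor`,
  `cycleForm_fstFactor_eq_point`: `[X₁ × 0] = pr₂^* vol_{X₂} = pr₂^*[pt_{X₂}]`** for every enumeration
  of the lattice basis of `X₁ × X₂` — the Künneth normalisation of Lange (2023), §6.2.4 (6.10)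
  (`p₁^*x = x ⊗ 1`, `p_{2*}(x ⊗ y) = d(x)·y`; dually the class of `X₁ × pt` is `1 ⊗ [pt]`), here for
  the cycle class `[Z] = (Φu) ⌟ vol` of `ComplexTorusSubtorusCycleClass.lean`.
* `torusIntegral_wedge_cycleForm_fstFactor`, **`torusIntegral_comp_fst_wedge_cycleForm_fstFactor`:
  `∫_{X₁ × X₂} pr₁^*η ∧ [X₁ × 0] = ∫_{X₁} η`** (Voisin (2002), Cor. 11.15: `∫_X η ∧ [Z] = ∫_Z η`).

Everything is proved; no named fact is introduced.

## References

* [Lange2023AbelianVarietiesComplex] H. Lange, *Abelian Varieties over the Complex Numbers* (2023),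
  §1.1.2, §6.2.4 (6.10) p. 310 (Künneth identification, `p₁^*x = x ⊗ 1`). Held copy
  `book:lange1992-complex-abelian-varieties`, chunk p0310.
* [Voisin2002] C. Voisin, *Hodge Theory and Complex Algebraic Geometry I* (2002), §11.1.2, Cor. 11.15,
  Remark 11.16.
* [LangeBirkenhake1992] H. Lange, Ch. Birkenhake, *Complex Abelian Varieties* (1992), §5.3 (products),
  Exercise 1.1.6 (2)(a) (complex subtori).
-/

noncomputable section

open scoped Manifold ContDiff Topology Real
open Set Function Complex Finset Module
open Literature.LinearAlgebra.Alternating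

namespace Literature.Geometry.Kaehler

/-! ### The orientation of a product of complex vector spaces -/

section Append

variable {W₁ W₂ : Type*} [AddCommGroup W₁] [Module ℂ W₁] [AddCommGroup W₂] [Module ℂ W₂]
  {q₁ q₂ N₁ N₂ : ℕ}

/-- Coordinates of the real basis of the product complex basis `(b₁, 0) ⊔ (0, b₂)` (interleaved):
on the first `N₁ = 2q₁` slots they are the coordinates of the first component in `(b₁ⱼ, i b₁ⱼ)ⱼ`.
[cite: Voisin2002, §11.1.2 Cor. 11.15] -/
theorem realBasisOfComplex_prod_repr_castAdd (b₁ : Basis (Fin q₁) ℂ W₁) (b₂ : Basis (Fin q₂) ℂ W₂)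
    (h₁ : q₁ * 2 = N₁) (h : (q₁ + q₂) * 2 = N₁ + N₂) (v : W₁ × W₂) (r₁ : Fin N₁) :
    ((realBasisOfComplex ((b₁.prod b₂).reindex finSumFinEquiv)).reindex (finCongr h)).repr v
        (Fin.castAdd N₂ r₁) =
      ((realBasisOfComplex b₁).reindex (finCongr h₁)).repr v.1 r₁ := by
  have hJ : ((finCongr h).symm (Fin.castAdd N₂ r₁)).divNat =
      Fin.castAdd q₂ ((finCongr h₁).symm r₁).divNat := by
    apply Fin.ext
    simp [Fin.coe_divNat]
  have hI : ((finCongr h).symm (Fin.castAdd N₂ r₁)).modNat = ((finCongr h₁).symm r₁).modNat := by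
    apply Fin.ext
    simp [Fin.coe_modNat]
  simp only [realBasisOfComplex, Basis.repr_reindex_apply, finProdFinEquiv_symm_apply,
    Basis.smulTower'_repr_mk, hJ, hI, finSumFinEquiv_symm_apply_castAdd, Basis.prod_repr_inl]

/-- Coordinates of the real basis of the product complex basis on the last `N₂ = 2q₂` slots: the
coordinates of the second component in `(b₂ⱼ, i b₂ⱼ)ⱼ`. [cite: Voisin2002, §11.1.2 Cor. 11.15] -/
theorem realBasisOfComplex_prod_repr_natAdd (b₁ : Basis (Fin q₁) ℂ W₁) (b₂ : Basis (Fin q₂) ℂ W₂)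
    (h₁ : q₁ * 2 = N₁) (h₂ : q₂ * 2 = N₂) (h : (q₁ + q₂) * 2 = N₁ + N₂) (v : W₁ × W₂) (r₂ : Fin N₂) :
    ((realBasisOfComplex ((b₁.prod b₂).reindex finSumFinEquiv)).reindex (finCongr h)).repr v
        (Fin.natAdd N₁ r₂) =
      ((realBasisOfComplex b₂).reindex (finCongr h₂)).repr v.2 r₂ := by
  have hJ : ((finCongr h).symm (Fin.natAdd N₁ r₂)).divNat =
      Fin.natAdd q₁ ((finCongr h₂).symm r₂).divNat := by
    apply Fin.ext
    simp only [Fin.coe_divNat, finCongr_symm, finCongr_apply, Fin.val_cast, Fin.val_natAdd]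
    omega
  have hI : ((finCongr h).symm (Fin.natAdd N₁ r₂)).modNat = ((finCongr h₂).symm r₂).modNat := by
    apply Fin.ext
    simp only [Fin.coe_modNat, finCongr_symm, finCongr_apply, Fin.val_cast, Fin.val_natAdd]
    omega
  simp only [realBasisOfComplex, Basis.repr_reindex_apply, finProdFinEquiv_symm_apply,
    Basis.smulTower'_repr_mk, hJ, hI, finSumFinEquiv_symm_apply_natAdd, Basis.prod_repr_inr]

/-- **The real basis of a product is block diagonal on product frames**: the determinant of the
frame `((w₁, 0), (0, w₂))` in the real basis of the product complex basis is the product of the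
determinants. [cite: Voisin2002, §11.1.2 Cor. 11.15] -/
theorem det_realBasisOfComplex_prod_append (b₁ : Basis (Fin q₁) ℂ W₁) (b₂ : Basis (Fin q₂) ℂ W₂)
    (h₁ : q₁ * 2 = N₁) (h₂ : q₂ * 2 = N₂) (h : (q₁ + q₂) * 2 = N₁ + N₂)
    (w₁ : Fin N₁ → W₁) (w₂ : Fin N₂ → W₂) :
    ((realBasisOfComplex ((b₁.prod b₂).reindex finSumFinEquiv)).reindex (finCongr h)).det
        (Fin.append (fun j ↦ (w₁ j, (0 : W₂))) (fun j ↦ ((0 : W₁), w₂ j))) =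
      ((realBasisOfComplex b₁).reindex (finCongr h₁)).det w₁ *
        ((realBasisOfComplex b₂).reindex (finCongr h₂)).det w₂ := by
  classical
  set R := (realBasisOfComplex ((b₁.prod b₂).reindex finSumFinEquiv)).reindex (finCongr h) with hR
  set R₁ := (realBasisOfComplex b₁).reindex (finCongr h₁) with hR₁
  set R₂ := (realBasisOfComplex b₂).reindex (finCongr h₂) with hR₂
  rw [Basis.det_apply, Basis.det_apply, Basis.det_apply]
  have hM : R.toMatrix (Fin.append (fun j ↦ (w₁ j, (0 : W₂))) (fun j ↦ ((0 : W₁), w₂ j))) =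
      (Matrix.fromBlocks (R₁.toMatrix w₁) 0 0 (R₂.toMatrix w₂)).submatrix
        finSumFinEquiv.symm finSumFinEquiv.symm := by
    ext r c
    refine Fin.addCases (fun r₁ ↦ ?_) (fun r₂ ↦ ?_) r <;>
      refine Fin.addCases (fun c₁ ↦ ?_) (fun c₂ ↦ ?_) c
    · rw [Basis.toMatrix_apply, Fin.append_left, Matrix.submatrix_apply,
        finSumFinEquiv_symm_apply_castAdd, finSumFinEquiv_symm_apply_castAdd,
        Matrix.fromBlocks_apply₁₁, Basis.toMatrix_apply, hR, hR₁,
        realBasisOfComplex_prod_repr_castAdd b₁ b₂ h₁ h]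
    · rw [Basis.toMatrix_apply, Fin.append_right, Matrix.submatrix_apply,
        finSumFinEquiv_symm_apply_castAdd, finSumFinEquiv_symm_apply_natAdd,
        Matrix.fromBlocks_apply₁₂, Matrix.zero_apply, hR,
        realBasisOfComplex_prod_repr_castAdd b₁ b₂ h₁ h, map_zero, Finsupp.zero_apply]
    · rw [Basis.toMatrix_apply, Fin.append_left, Matrix.submatrix_apply,
        finSumFinEquiv_symm_apply_natAdd, finSumFinEquiv_symm_apply_castAdd,
        Matrix.fromBlocks_apply₂₁, Matrix.zero_apply, hR,
        realBasisOfComplex_prod_repr_natAdd b₁ b₂ h₁ h₂ h, map_zero, Finsupp.zero_apply]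
    · rw [Basis.toMatrix_apply, Fin.append_right, Matrix.submatrix_apply,
        finSumFinEquiv_symm_apply_natAdd, finSumFinEquiv_symm_apply_natAdd,
        Matrix.fromBlocks_apply₂₂, Basis.toMatrix_apply, hR, hR₂,
        realBasisOfComplex_prod_repr_natAdd b₁ b₂ h₁ h₂ h]
  rw [hM, Matrix.det_submatrix_equiv_self, Matrix.det_fromBlocks_zero₂₁]

/-- **The product of positively oriented frames is positively oriented**: if `w₁`, `w₂` are
positively oriented real frames of the complex vector spaces `W₁`, `W₂`, the concatenated frame
`((w₁ⱼ, 0))ⱼ ⊔ ((0, w₂ⱼ))ⱼ` of `W₁ × W₂` is positively oriented (the canonical orientation of a product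
of complex manifolds is the product orientation; Griffiths–Harris Ch. 0 §2).
[cite: Voisin2002, §11.1.2 Cor. 11.15] -/
theorem IsPosOriented.append {w₁ : Fin N₁ → W₁} {w₂ : Fin N₂ → W₂} (hw₁ : IsPosOriented w₁)
    (hw₂ : IsPosOriented w₂) :
    IsPosOriented (Fin.append (fun j ↦ (w₁ j, (0 : W₂))) (fun j ↦ ((0 : W₁), w₂ j))) := by
  classical
  obtain ⟨q₁, h₁, b₁, hb₁⟩ := hw₁
  obtain ⟨q₂, h₂, b₂, hb₂⟩ := hw₂
  have h : (q₁ + q₂) * 2 = N₁ + N₂ := by rw [add_mul, h₁, h₂]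
  refine ⟨q₁ + q₂, h, (b₁.prod b₂).reindex finSumFinEquiv, ?_⟩
  rw [det_realBasisOfComplex_prod_append b₁ b₂ h₁ h₂ h]
  exact mul_pos hb₁ hb₂

end Append

namespace ComplexTorus

/-! ### The factor subtorus `X₁ × {0} ⊂ X₁ × X₂` -/

section FstFactor

variable {ι₁ ι₂ : Type*} [Fintype ι₁] [Fintype ι₂] [DecidableEq ι₁] [DecidableEq ι₂]
  {E₁ E₂ : Type*} [NormedAddCommGroup E₁] [NormedSpace ℂ E₁] [NormedAddCommGroup E₂] [NormedSpace ℂ E₂]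
  (Φ₁ : (ι₁ → ℝ) ≃L[ℝ] E₁) (Φ₂ : (ι₂ → ℝ) ≃L[ℝ] E₂) {N₁ N₂ : ℕ}

/-- **The concatenated enumeration** of the lattice basis of `X₁ × X₂`: first the basis of `Λ₁` in the
order `e₁`, then that of `Λ₂` in the order `e₂`. [cite: LangeBirkenhake1992, §5.3] -/
def sumEnum (e₁ : Fin N₁ ≃ ι₁) (e₂ : Fin N₂ ≃ ι₂) : Fin (N₁ + N₂) ≃ ι₁ ⊕ ι₂ :=
  finSumFinEquiv.symm.trans (e₁.sumCongr e₂)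

omit [Fintype ι₁] [Fintype ι₂] [DecidableEq ι₁] [DecidableEq ι₂] in
/-- The head of the concatenated enumeration. [cite: LangeBirkenhake1992, §5.3] -/
@[simp] theorem sumEnum_castAdd (e₁ : Fin N₁ ≃ ι₁) (e₂ : Fin N₂ ≃ ι₂) (i : Fin N₁) :
    sumEnum e₁ e₂ (Fin.castAdd N₂ i) = Sum.inl (e₁ i) := by
  simp [sumEnum]

omit [Fintype ι₁] [Fintype ι₂] [DecidableEq ι₁] [DecidableEq ι₂] in
/-- The tail of the concatenated enumeration. [cite: LangeBirkenhake1992, §5.3] -/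
@[simp] theorem sumEnum_natAdd (e₁ : Fin N₁ ≃ ι₁) (e₂ : Fin N₂ ≃ ι₂) (j : Fin N₂) :
    sumEnum e₁ e₂ (Fin.natAdd N₁ j) = Sum.inr (e₂ j) := by
  simp [sumEnum]

/-- **The frame of the first factor**: the lattice basis of `Λ₁ ⊕ 0` in the order `e₁`.
[cite: LangeBirkenhake1992, §5.3] -/
def fstFrame (e₁ : Fin N₁ ≃ ι₁) : Fin N₁ → (ι₁ ⊕ ι₂ → ℤ) := fun j ↦ Pi.single (Sum.inl (e₁ j)) 1

/-- Lattice vectors of `Λ₁ ⊕ 0` are `(λₐ, 0)`. [cite: LangeBirkenhake1992, §5.3] -/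
theorem latticeVec_prodPeriod_single_inl (a : ι₁) :
    latticeVec (prodPeriod Φ₁ Φ₂) (Pi.single (Sum.inl a) 1) = (Φ₁ (Pi.single a (1 : ℝ)), 0) := by
  rw [latticeVec_prodPeriod]
  have h1 : (fun i ↦ (Pi.single (Sum.inl a) (1 : ℤ) : ι₁ ⊕ ι₂ → ℤ) (Sum.inl i)) = Pi.single a 1 := by
    funext i
    by_cases h : i = a
    · subst h; simp
    · simp [h]
  have h2 : (fun j ↦ (Pi.single (Sum.inl a) (1 : ℤ) : ι₁ ⊕ ι₂ → ℤ) (Sum.inr j)) = 0 := by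
    funext j; simp
  have h0 : latticeVec Φ₂ (0 : ι₂ → ℤ) = 0 := by
    simp only [latticeVec, Pi.zero_apply, Int.cast_zero]; exact map_zero Φ₂
  rw [h1, h2, latticeVec_single, h0]

/-- The frame of the first factor consists of the vectors `(λ_{e₁ j}, 0)`.
[cite: LangeBirkenhake1992, §5.3] -/
theorem latticeTuple_fstFrame (e₁ : Fin N₁ ≃ ι₁) :
    latticeTuple (prodPeriod Φ₁ Φ₂) (fstFrame (ι₂ := ι₂) e₁) =
      fun j ↦ ((latticeFrame Φ₁ e₁ j, (0 : E₂)) : E₁ × E₂) := by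
  funext j
  rw [latticeTuple_apply, fstFrame, latticeVec_prodPeriod_single_inl, latticeFrame_apply]

/-- The lattice basis of `E₁` spans `E₁` over `ℂ`. [cite: Lange2023AbelianVarietiesComplex, §1.1.2] -/
theorem span_latticeFrame_eq_top (e₁ : Fin N₁ ≃ ι₁) :
    Submodule.span ℂ (Set.range (latticeFrame Φ₁ e₁)) = ⊤ := by
  rw [eq_top_iff]
  intro x _
  have hx : x ∈ Submodule.span ℝ (Set.range ⇑(latticeBasis Φ₁ e₁)) := by
    rw [(latticeBasis Φ₁ e₁).span_eq]; exact Submodule.mem_top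
  rw [coe_latticeBasis] at hx
  exact Submodule.span_le_restrictScalars ℝ ℂ _ hx

/-- The complex span of the frame of the first factor is `E₁ × 0`. [cite: LangeBirkenhake1992, §5.3] -/
theorem frameSpan_fstFrame (e₁ : Fin N₁ ≃ ι₁) :
    frameSpan (prodPeriod Φ₁ Φ₂) (fstFrame (ι₂ := ι₂) e₁) = LinearMap.range (LinearMap.inl ℂ E₁ E₂) := by
  rw [frameSpan, latticeTuple_fstFrame]
  have hr : Set.range (fun j ↦ ((latticeFrame Φ₁ e₁ j, (0 : E₂)) : E₁ × E₂)) =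
      (LinearMap.inl ℂ E₁ E₂) '' Set.range (latticeFrame Φ₁ e₁) := by
    rw [← Set.range_comp]; rfl
  rw [hr, Submodule.span_image, span_latticeFrame_eq_top, Submodule.map_top]

/-- `E₁ ≃ E₁ × 0`, the complex span of the frame of the first factor. [cite: LangeBirkenhake1992, §5.3] -/
def fstSpanEquiv (e₁ : Fin N₁ ≃ ι₁) : E₁ ≃ₗ[ℂ] frameSpan (prodPeriod Φ₁ Φ₂) (fstFrame (ι₂ := ι₂) e₁) :=
  (LinearEquiv.ofInjective (LinearMap.inl ℂ E₁ E₂) LinearMap.inl_injective).trans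
    (LinearEquiv.ofEq _ _ (frameSpan_fstFrame Φ₁ Φ₂ e₁).symm)

/-- `fstSpanEquiv x = (x, 0)`. [cite: LangeBirkenhake1992, §5.3] -/
@[simp] theorem coe_fstSpanEquiv (e₁ : Fin N₁ ≃ ι₁) (x : E₁) :
    ((fstSpanEquiv Φ₁ Φ₂ (ι₂ := ι₂) e₁ x : frameSpan (prodPeriod Φ₁ Φ₂) (fstFrame e₁)) : E₁ × E₂) = (x, 0) := by
  simp [fstSpanEquiv, LinearEquiv.ofInjective_apply]

/-- **The factor subtorus `X₁ × {0} ⊂ X₁ × X₂` as a subtorus datum** (frame = the lattice basis of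
`Λ₁ ⊕ 0` in a positively oriented enumeration `e₁`; `m = 2 dim X₁`, codimension `dim X₂`): it is
saturated and positively oriented — a complex subtorus of every intermediate codimension
(Lange–Birkenhake, Exercise 1.1.6 (2)(a); §5.3 products). [cite: LangeBirkenhake1992, §5.3] -/
def SubtorusFrame.fstFactor (e₁ : Fin N₁ ≃ ι₁) (he₁ : orientationSign Φ₁ e₁ = 1) :
    SubtorusFrame (prodPeriod Φ₁ Φ₂) N₁ where
  frame := fstFrame e₁
  saturated n hn := by
    -- the second component vanishes on the real span of the frame
    have h2 : ∀ x ∈ Submodule.span ℝ (Set.range (latticeTuple (prodPeriod Φ₁ Φ₂) (fstFrame (ι₂ := ι₂) e₁))),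
        x.2 = 0 := by
      intro x hx
      refine Submodule.span_induction (fun y hy ↦ ?_) rfl (fun a b _ _ ha hb ↦ ?_) (fun c a _ ha ↦ ?_) hx
      · obtain ⟨j, rfl⟩ := hy
        rw [latticeTuple_fstFrame]
      · rw [Prod.snd_add, ha, hb, add_zero]
      · rw [Prod.smul_snd, ha, smul_zero]
    have hn2 : latticeVec Φ₂ (fun j ↦ n (Sum.inr j)) = 0 := by
      have h := h2 _ hn
      rwa [latticeVec_prodPeriod] at h
    have hz : ∀ j, n (Sum.inr j) = 0 := fun j ↦ by
      have h := symm_latticeVec_apply Φ₂ (fun j ↦ n (Sum.inr j)) j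
      rw [hn2, map_zero, Pi.zero_apply] at h
      exact_mod_cast h.symm
    rw [Submodule.mem_span_range_iff_exists_fun]
    refine ⟨fun j ↦ n (Sum.inl (e₁ j)), ?_⟩
    funext x
    rw [Finset.sum_apply]
    cases x with
    | inl a =>
      simp only [Pi.smul_apply, fstFrame, smul_eq_mul]
      rw [Finset.sum_eq_single (e₁.symm a)]
      · simp
      · intro j _ hj
        have hne : Sum.inl (e₁ j) ≠ (Sum.inl a : ι₁ ⊕ ι₂) := fun h ↦ hj (by
          rw [Equiv.eq_symm_apply]; exact Sum.inl_injective h)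
        rw [Pi.single_eq_of_ne' hne, mul_zero]
      · intro h; exact absurd (Finset.mem_univ _) h
    | inr b =>
      rw [hz b]
      refine Finset.sum_eq_zero fun j _ ↦ ?_
      simp [fstFrame]
  posOriented := by
    have hpos : IsPosOriented (latticeFrame Φ₁ e₁) := (orientationSign_eq_one_iff Φ₁ e₁).1 he₁
    have hcomp : frameInSpan (prodPeriod Φ₁ Φ₂) (fstFrame (ι₂ := ι₂) e₁) =
        ⇑(fstSpanEquiv Φ₁ Φ₂ e₁) ∘ latticeFrame Φ₁ e₁ := by
      funext j
      apply Subtype.ext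
      rw [coe_frameInSpan, latticeTuple_fstFrame, comp_apply, coe_fstSpanEquiv]
    rw [hcomp]
    exact hpos.comp_linearEquiv _

/-- The real span of the factor datum is `E₁ × 0`. [cite: LangeBirkenhake1992, §5.3] -/
theorem SubtorusFrame.mem_realSpan_fstFactor_iff (e₁ : Fin N₁ ≃ ι₁) (he₁ : orientationSign Φ₁ e₁ = 1)
    (x : E₁ × E₂) : x ∈ (SubtorusFrame.fstFactor Φ₁ Φ₂ e₁ he₁).realSpan ↔ x.2 = 0 := by
  rw [SubtorusFrame.realSpan_eq_restrictScalars, Submodule.restrictScalars_mem]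
  change x ∈ frameSpan (prodPeriod Φ₁ Φ₂) (fstFrame e₁) ↔ _
  rw [frameSpan_fstFrame, LinearMap.range_inl, LinearMap.mem_ker, LinearMap.snd_apply]

omit [DecidableEq ι₁] [DecidableEq ι₂] in
/-- The product identification commutes with the covering maps of `E₁ × E₂`, `E₁`, `E₂`:
`prodHomeomorph (cover (x, y)) = (cover x, cover y)`. [cite: LangeBirkenhake1992, §5.3] -/
theorem prodHomeomorph_cover (x : E₁ × E₂) :
    prodHomeomorph Φ₁ Φ₂ (cover (prodPeriod Φ₁ Φ₂) x) = (cover Φ₁ x.1, cover Φ₂ x.2) := by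
  rw [cover_apply, prodPeriod_symm_apply, prodHomeomorph_proj]
  rfl

/-- **The factor datum presents `X₁ × {0}`**: under the product identification
`X₁ × X₂ ≃ₜ ComplexTorus Φ₁ × ComplexTorus Φ₂` its carrier (through `0`) is `X₁ × {0}`.
[cite: LangeBirkenhake1992, §5.3] -/
theorem SubtorusFrame.image_carrier_fstFactor (e₁ : Fin N₁ ≃ ι₁) (he₁ : orientationSign Φ₁ e₁ = 1) :
    prodHomeomorph Φ₁ Φ₂ '' (SubtorusFrame.fstFactor Φ₁ Φ₂ e₁ he₁).carrier 0 = Set.univ ×ˢ {0} := by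
  ext ⟨t₁, t₂⟩
  simp only [SubtorusFrame.carrier, Set.image_image, zero_add, prodHomeomorph_cover, Set.mem_image,
    SetLike.mem_coe, SubtorusFrame.mem_realSpan_fstFactor_iff, Set.mem_prod, Set.mem_univ, true_and,
    Set.mem_singleton_iff, Prod.mk.injEq]
  constructor
  · rintro ⟨x, hx, -, h⟩
    rw [← h, hx, cover_zero]
  · rintro rfl
    obtain ⟨z₁, hz₁⟩ := cover_surjective Φ₁ t₁
    exact ⟨(z₁, 0), rfl, hz₁, cover_zero Φ₂⟩

/-! ### The class of the factor subtorus: `[X₁ × 0] = pr₂^* [pt]` -/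

omit [DecidableEq ι₂] in
/-- **Block determinant**: in the concatenated lattice basis, the determinant of the frame
`(λ₁, 0) ⊔ v` is the determinant of the second components of `v` in the lattice basis of `E₂`
(upper block-triangular matrix with identity top-left block). [cite: Lange2023AbelianVarietiesComplex, §6.2.4 (6.10)] -/
theorem latticeBasis_det_sumEnum_append (e₁ : Fin N₁ ≃ ι₁) (e₂ : Fin N₂ ≃ ι₂) (v : Fin N₂ → E₁ × E₂) :
    (latticeBasis (prodPeriod Φ₁ Φ₂) (sumEnum e₁ e₂)).det
        (Fin.append (fun j ↦ ((latticeFrame Φ₁ e₁ j, (0 : E₂)) : E₁ × E₂)) v) =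
      (latticeBasis Φ₂ e₂).det (Prod.snd ∘ v) := by
  classical
  rw [Basis.det_apply, Basis.det_apply]
  have hM : (latticeBasis (prodPeriod Φ₁ Φ₂) (sumEnum e₁ e₂)).toMatrix
      (Fin.append (fun j ↦ ((latticeFrame Φ₁ e₁ j, (0 : E₂)) : E₁ × E₂)) v) =
      (Matrix.fromBlocks (1 : Matrix (Fin N₁) (Fin N₁) ℝ) (Matrix.of fun i j ↦ Φ₁.symm (v j).1 (e₁ i))
        0 ((latticeBasis Φ₂ e₂).toMatrix (Prod.snd ∘ v))).submatrix
          finSumFinEquiv.symm finSumFinEquiv.symm := by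
    ext r c
    refine Fin.addCases (fun r₁ ↦ ?_) (fun r₂ ↦ ?_) r <;>
      refine Fin.addCases (fun c₁ ↦ ?_) (fun c₂ ↦ ?_) c
    · rw [Basis.toMatrix_apply, latticeBasis_repr, Fin.append_left, Matrix.submatrix_apply,
        finSumFinEquiv_symm_apply_castAdd, finSumFinEquiv_symm_apply_castAdd,
        Matrix.fromBlocks_apply₁₁, sumEnum_castAdd, prodPeriod_symm_apply, Sum.elim_inl,
        latticeFrame_apply, ContinuousLinearEquiv.symm_apply_apply, Matrix.one_apply,
        Pi.single_apply]
      simp only [EmbeddingLike.apply_eq_iff_eq]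
    · rw [Basis.toMatrix_apply, latticeBasis_repr, Fin.append_right, Matrix.submatrix_apply,
        finSumFinEquiv_symm_apply_castAdd, finSumFinEquiv_symm_apply_natAdd,
        Matrix.fromBlocks_apply₁₂, sumEnum_castAdd, prodPeriod_symm_apply, Sum.elim_inl,
        Matrix.of_apply]
    · rw [Basis.toMatrix_apply, latticeBasis_repr, Fin.append_left, Matrix.submatrix_apply,
        finSumFinEquiv_symm_apply_natAdd, finSumFinEquiv_symm_apply_castAdd,
        Matrix.fromBlocks_apply₂₁, sumEnum_natAdd, prodPeriod_symm_apply, Sum.elim_inr,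
        map_zero, Pi.zero_apply, Matrix.zero_apply]
    · rw [Basis.toMatrix_apply, latticeBasis_repr, Fin.append_right, Matrix.submatrix_apply,
        finSumFinEquiv_symm_apply_natAdd, finSumFinEquiv_symm_apply_natAdd,
        Matrix.fromBlocks_apply₂₂, sumEnum_natAdd, prodPeriod_symm_apply, Sum.elim_inr,
        Basis.toMatrix_apply, latticeBasis_repr, comp_apply]
  rw [hM, Matrix.det_submatrix_equiv_self, Matrix.det_fromBlocks_zero₂₁, Matrix.det_one, one_mul]

/-- **The orientation sign of the concatenated enumeration** is that of the second factor when the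
first is positively oriented (the canonical orientation of `X₁ × X₂` is the product orientation).
[cite: Voisin2002, §11.1.2 Cor. 11.15] -/
theorem orientationSign_sumEnum (e₁ : Fin N₁ ≃ ι₁) (e₂ : Fin N₂ ≃ ι₂)
    (he₁ : orientationSign Φ₁ e₁ = 1) :
    orientationSign (prodPeriod Φ₁ Φ₂) (sumEnum e₁ e₂) = orientationSign Φ₂ e₂ := by
  classical
  haveI := finiteDimensional_real Φ₂ e₂
  haveI : FiniteDimensional ℂ E₂ := Module.Finite.of_restrictScalars_finite ℝ ℂ E₂
  have hq₂ := finrank_complex_mul_two Φ₂ e₂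
  set q₂ := Module.finrank ℂ E₂
  let b₂ : Basis (Fin q₂) ℂ E₂ := Module.finBasis ℂ E₂
  set R₂ : Fin N₂ → E₂ := ⇑((realBasisOfComplex b₂).reindex (finCongr hq₂)) with hR₂
  have hR₂pos : IsPosOriented R₂ := isPosOriented_realBasisOfComplex hq₂ b₂
  have h₁ : IsPosOriented (latticeFrame Φ₁ e₁) := (orientationSign_eq_one_iff Φ₁ e₁).1 he₁
  have hpos : IsPosOriented (Fin.append (fun j ↦ ((latticeFrame Φ₁ e₁ j, (0 : E₂)) : E₁ × E₂))
      (fun j ↦ (((0 : E₁), R₂ j) : E₁ × E₂))) := h₁.append hR₂pos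
  have hX := volumeForm_apply_pos_of_isPosOriented (prodPeriod Φ₁ Φ₂) (sumEnum e₁ e₂) hpos
  rw [latticeBasis_det_sumEnum_append] at hX
  have hsnd : (Prod.snd ∘ fun j ↦ (((0 : E₁), R₂ j) : E₁ × E₂)) = R₂ := by funext j; rfl
  rw [hsnd] at hX
  have h2 := volumeForm_apply_pos_of_isPosOriented Φ₂ e₂ hR₂pos
  rcases orientationSign_eq_or (prodPeriod Φ₁ Φ₂) (sumEnum e₁ e₂) with hs | hs <;>
    rcases orientationSign_eq_or Φ₂ e₂ with hs' | hs' <;> rw [hs, hs'] <;>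
    simp only [hs, hs', Int.cast_one, Int.cast_neg, one_mul, neg_mul] at hX h2 <;> linarith

/-- The cycle class does not depend on the enumeration used for the volume form.
[cite: Lange2023AbelianVarietiesComplex, §6.2.4 p. 310] -/
theorem cycleFormOfFrame_eq_of_enum {ι : Type*} [Fintype ι] [DecidableEq ι] {E : Type*}
    [NormedAddCommGroup E] [NormedSpace ℂ E] (Φ : (ι → ℝ) ≃L[ℝ] E) {m k : ℕ}
    (e e' : Fin (m + k) ≃ ι) (u : Fin m → (ι → ℤ)) :
    cycleFormOfFrame Φ e u = cycleFormOfFrame Φ e' u := by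
  unfold cycleFormOfFrame
  rw [volumeForm_eq_volumeForm Φ e e']

/-- **`[X₁ × 0] = pr₂^*[pt_{X₂}]`** — the cycle class of the factor subtorus `X₁ × {0} ⊂ X₁ × X₂`,
computed in the concatenated enumeration: `[X₁ × 0](v₁, …, v_{N₂}) = vol_{X₂}(pr₂ v₁, …, pr₂ v_{N₂})`
(Künneth normalisation, Lange (2023), §6.2.4 (6.10): `p₁^* x = x ⊗ 1`; the class of `X₁ × pt` is
`1 ⊗ [pt]`). [cite: Lange2023AbelianVarietiesComplex, §6.2.4 (6.10) p. 310] -/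
theorem SubtorusFrame.cycleForm_fstFactor_apply (e₁ : Fin N₁ ≃ ι₁) (e₂ : Fin N₂ ≃ ι₂)
    (he₁ : orientationSign Φ₁ e₁ = 1) (v : Fin N₂ → E₁ × E₂) :
    (SubtorusFrame.fstFactor Φ₁ Φ₂ e₁ he₁).cycleForm (sumEnum e₁ e₂) v =
      volumeForm Φ₂ e₂ (Prod.snd ∘ v) := by
  rw [SubtorusFrame.cycleForm, cycleFormOfFrame_apply]
  change volumeForm _ _ (Fin.append (latticeTuple (prodPeriod Φ₁ Φ₂) (fstFrame e₁)) v) = _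
  rw [latticeTuple_fstFrame, volumeForm_apply, volumeForm_apply, latticeBasis_det_sumEnum_append,
    orientationSign_sumEnum Φ₁ Φ₂ e₁ e₂ he₁]

/-- **`[X₁ × 0] = pr₂^* vol_{X₂}`** as invariant forms, for ANY enumeration `e` of the lattice basis of
`X₁ × X₂` (the volume form is independent of the enumeration). [cite: Lange2023AbelianVarietiesComplex, §6.2.4 (6.10) p. 310] -/
theorem SubtorusFrame.cycleForm_fstFactor (e₁ : Fin N₁ ≃ ι₁) (e₂ : Fin N₂ ≃ ι₂)
    (he₁ : orientationSign Φ₁ e₁ = 1) (e : Fin (N₁ + N₂) ≃ ι₁ ⊕ ι₂) :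
    (SubtorusFrame.fstFactor Φ₁ Φ₂ e₁ he₁).cycleForm e =
      (volumeForm Φ₂ e₂).compContinuousLinearMap (ContinuousLinearMap.snd ℝ E₁ E₂) := by
  ext v
  rw [SubtorusFrame.cycleForm, cycleFormOfFrame_eq_of_enum _ e (sumEnum e₁ e₂), ← SubtorusFrame.cycleForm,
    SubtorusFrame.cycleForm_fstFactor_apply, ContinuousAlternatingMap.compContinuousLinearMap_apply]
  rfl

/-- **`[X₁ × 0]` is the pull-back of a positive integral generator**: it is integral and
`∫_{X₁ × X₂} η ∧ [X₁ × 0] = η((λ_{e₁ j}, 0)ⱼ)` (`= ∫_{X₁ × 0} η`).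
[cite: Voisin2002, §11.1.2 Cor. 11.15] -/
theorem SubtorusFrame.torusIntegral_wedge_cycleForm_fstFactor (e₁ : Fin N₁ ≃ ι₁) (e₂ : Fin N₂ ≃ ι₂)
    (he₁ : orientationSign Φ₁ e₁ = 1) (η : (E₁ × E₂) [⋀^Fin N₁]→L[ℝ] ℂ) :
    torusIntegral (prodPeriod Φ₁ Φ₂) (sumEnum e₁ e₂)
        (η.wedge ((SubtorusFrame.fstFactor Φ₁ Φ₂ e₁ he₁).cycleForm (sumEnum e₁ e₂))) =
      η (fun j ↦ ((latticeFrame Φ₁ e₁ j, (0 : E₂)) : E₁ × E₂)) := by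
  rw [SubtorusFrame.torusIntegral_wedge_cycleForm]
  change η (latticeTuple (prodPeriod Φ₁ Φ₂) (fstFrame e₁)) = _
  rw [latticeTuple_fstFrame]

/-- **`[X₁ × 0] = pr₂^*[pt_{X₂}]` in the graded piece `H^{2p}`** (`2p = 2 dim X₂`, the enumeration-free
packaging `cycleClass`). [cite: Lange2023AbelianVarietiesComplex, §6.2.4 (6.10) p. 310] -/
theorem SubtorusFrame.cycleClass_fstFactor (e₁ : Fin N₁ ≃ ι₁) (he₁ : orientationSign Φ₁ e₁ = 1) (p : ℕ)
    (h : N₁ + 2 * p = Fintype.card (ι₁ ⊕ ι₂)) (e₂ : Fin (2 * p) ≃ ι₂) :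
    (SubtorusFrame.fstFactor Φ₁ Φ₂ e₁ he₁).cycleClass p h =
      (volumeForm Φ₂ e₂).compContinuousLinearMap (ContinuousLinearMap.snd ℝ E₁ E₂) :=
  SubtorusFrame.cycleForm_fstFactor Φ₁ Φ₂ e₁ e₂ he₁ _

/-- **`[X₁ × 0] = pr₂^*[pt_{X₂}]` literally**, with the point class `[pt_{X₂}] = vol_{X₂}` of
`SubtorusFrame.point` (`cycleForm_point`). [cite: Lange2023AbelianVarietiesComplex, §6.2.4 (6.10) p. 310] -/
theorem SubtorusFrame.cycleForm_fstFactor_eq_point (e₁ : Fin N₁ ≃ ι₁) (e₂ : Fin N₂ ≃ ι₂)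
    (he₁ : orientationSign Φ₁ e₁ = 1) (e : Fin (N₁ + N₂) ≃ ι₁ ⊕ ι₂) :
    (SubtorusFrame.fstFactor Φ₁ Φ₂ e₁ he₁).cycleForm e =
      ((SubtorusFrame.point (Φ := Φ₂)).cycleForm ((finCongr (Nat.zero_add N₂)).trans e₂)).compContinuousLinearMap
        (ContinuousLinearMap.snd ℝ E₁ E₂) := by
  ext v
  rw [SubtorusFrame.cycleForm_fstFactor Φ₁ Φ₂ e₁ e₂ he₁,
    ContinuousAlternatingMap.compContinuousLinearMap_apply,
    ContinuousAlternatingMap.compContinuousLinearMap_apply, SubtorusFrame.cycleForm_point,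
    volumeForm_apply, volumeForm_apply]
  have hN : ∀ {N' : ℕ} (h : N' = N₂) (w : Fin N₂ → E₂),
      (orientationSign Φ₂ ⇑((finCongr h).trans e₂) : ℝ) *
          (latticeBasis Φ₂ ((finCongr h).trans e₂)).det (w ∘ Fin.cast h) =
        orientationSign Φ₂ e₂ * (latticeBasis Φ₂ e₂).det w := by
    intro N' h w
    subst h
    rfl
  rw [hN]

/-- **Projection formula for the factor subtorus**: `∫_{X₁ × X₂} pr₁^*η ∧ [X₁ × 0] = ∫_{X₁} η` for every
top-degree invariant form `η` of `X₁`. [cite: Voisin2002, §11.1.2 Cor. 11.15] -/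
theorem SubtorusFrame.torusIntegral_comp_fst_wedge_cycleForm_fstFactor (e₁ : Fin N₁ ≃ ι₁)
    (e₂ : Fin N₂ ≃ ι₂) (he₁ : orientationSign Φ₁ e₁ = 1) (η : E₁ [⋀^Fin N₁]→L[ℝ] ℂ) :
    torusIntegral (prodPeriod Φ₁ Φ₂) (sumEnum e₁ e₂)
        ((η.compContinuousLinearMap (ContinuousLinearMap.fst ℝ E₁ E₂)).wedge
          ((SubtorusFrame.fstFactor Φ₁ Φ₂ e₁ he₁).cycleForm (sumEnum e₁ e₂))) =
      torusIntegral Φ₁ e₁ η := by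
  rw [SubtorusFrame.torusIntegral_wedge_cycleForm_fstFactor,
    ContinuousAlternatingMap.compContinuousLinearMap_apply, torusIntegral, he₁, Int.cast_one, one_mul]
  rfl

end FstFactor

end ComplexTorus

end Literature.Geometry.Kaehler

end
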